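import Summits.ValiantsHypothesis.ValiantsHypothesis.Theorems.LacunarySymmetroidMatrixDescartesDoorA26WallBubblingBubblingTwistedRolle

/-!
# Wall bubbling for `DoorA26` — (W) chain piece: DERIVATIVE TOWERS (glue for the multiplicity transfer)

HONEST FRAMING.  Chain lemmas for obligation (W) `stub_weylFaces` of `Cruxes/DoorA26/Lines/wall_bubbling.lean` (stmt-ValiantsHypothesis-19979
`DoorA26`; OPEN, typed, never asserted), re-pointed seat val-sym-door-p1 g13 (W2 #9).  Glue between the chain's cluster functions
(`Bubbling.expSum a x t = Σ_i a_i e^{x_i t}`) and the tower currency of W2 #5/#7/#8 (`multiplicity_transfer`, `no_twenty_window_of_confluentDoor`,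
`classTower_limit`):

* `iteratedDeriv_eq_of_tower` — a function tower closed under differentiation (`HasDerivAt (Fd j) (Fd (j+1) t) t`) IS the `iteratedDeriv` tower of
  its ground floor (so an explicitly written limit tower identifies with `iteratedDeriv j F`, as the door `ConfluentDoor26` wants);
* `iteratedDeriv_expSum` — `iteratedDeriv j (expSum a x) = expSum (a · x^j) x`; `contDiff_expSum`;
* `expSum_classWeights` — inside a value class `x_i = E + ε_i` the `j`-th derivative weights regroup binomially:
  `Σ_i a_i x_i^j e^{x_i t} = e^{E t} Σ_{r ≤ j} C(j,r) E^{j−r} (Σ_i a_i ε_i^r e^{ε_i t})` — the `ε^r`-weighted class functions of `classTower_limit`.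

No new definitions; nothing here bears on `DoorA26`, `MatrixDescartes` (stmt-ValiantsHypothesis-18050) or `VP ≠ VNP`.

[folklore] Elementary calculus; binomial theorem.
-/

-- `Summit.ValiantsHypothesis.ValiantsHypothesis.…` repeats a component by the D-0017 layout
-- (single-conjunct summit), which the `dupNamespace` linter flags; the name is mandated.
set_option linter.dupNamespace false

namespace Summit.ValiantsHypothesis.ValiantsHypothesis.Theorems.LacunarySymmetroidMatrixDescartes.WallBubbling

open Finset
open scoped BigOperators

/-- A tower closed under differentiation is the `iteratedDeriv` tower of its ground floor. [folklore] -/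
theorem iteratedDeriv_eq_of_tower (Fd : ℕ → ℝ → ℝ) (hF : ∀ j t, HasDerivAt (Fd j) (Fd (j + 1) t) t) :
    ∀ j, iteratedDeriv j (Fd 0) = Fd j := by
  intro j
  induction j with
  | zero => simp
  | succ j ih =>
    rw [iteratedDeriv_succ, ih]
    funext t
    exact (hF j t).deriv

/-- `iteratedDeriv j (expSum a x) = expSum (a · x^j) x`. [folklore] -/
theorem iteratedDeriv_expSum {ι : Type*} [Fintype ι] (a x : ι → ℝ) (j : ℕ) :
    iteratedDeriv j (Bubbling.expSum a x) = Bubbling.expSum (fun i => a i * x i ^ j) x := by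
  have h := iteratedDeriv_eq_of_tower (fun j => Bubbling.expSum (fun i => a i * x i ^ j) x) (fun j t => by
    have := Bubbling.hasDerivAt_expSum (fun i => a i * x i ^ j) x t
    simp only [mul_assoc, ← pow_succ] at this
    exact this) j
  simpa using h

/-- Exponential sums are smooth. [folklore] -/
theorem contDiff_expSum {ι : Type*} [Fintype ι] (a x : ι → ℝ) (n : ℕ) : ContDiff ℝ n (Bubbling.expSum a x) := by
  have hfun : Bubbling.expSum a x = fun s => ∑ i, a i * Real.exp (x i * s) := rfl
  rw [hfun]
  exact ContDiff.sum fun i _ => contDiff_const.mul (Real.contDiff_exp.comp (contDiff_const.mul contDiff_id))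

/-- **Binomial regrouping of the derivative weights inside a value class.**  With `x_i = E + ε_i`:
`Σ_i a_i x_i^j e^{x_i t} = e^{E t} Σ_{r ∈ range (j+1)} C(j,r) E^{j−r} (Σ_i a_i ε_i^r e^{ε_i t})`. [folklore] -/
theorem expSum_classWeights {ι : Type*} [Fintype ι] (a ε : ι → ℝ) (E t : ℝ) (j : ℕ) :
    ∑ i, a i * (E + ε i) ^ j * Real.exp ((E + ε i) * t)
      = Real.exp (E * t) * ∑ r ∈ Finset.range (j + 1), (j.choose r : ℝ) * E ^ (j - r) * (∑ i, a i * ε i ^ r * Real.exp (ε i * t)) := by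
  -- expand `(E + ε)^j` binomially and `e^{(E+ε)t} = e^{Et} e^{εt}`, then swap the sums
  have hexp : ∀ i, Real.exp ((E + ε i) * t) = Real.exp (E * t) * Real.exp (ε i * t) := by
    intro i; rw [add_mul, Real.exp_add]
  simp_rw [hexp, add_comm E, add_pow]
  rw [Finset.mul_sum]
  simp_rw [Finset.mul_sum, Finset.sum_mul]
  rw [Finset.sum_comm]
  refine Finset.sum_congr rfl fun r _ => Finset.sum_congr rfl fun i _ => ?_
  ring

end Summit.ValiantsHypothesis.ValiantsHypothesis.Theorems.LacunarySymmetroidMatrixDescartes.WallBubbling
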